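import Mathlib
import Literature.Analysis.ODE.SchrodingerODE
import HarnessLib

/-!
# The dominant solution `v ~ z^{n+1}` and the Wronskian, by reduction of order

Analysis/ODE support file (everything proved, no definitions). Let `P` be continuous and `U` a global
solution of `U'' = P U` which is recessive of order `n` beyond `A ≥ 1` in the quantitative sense
`|zⁿU − 1| ≤ η`, `|zⁿ⁺¹U' + n zⁿU| ≤ η` (`z > A`, `η ≤ ½`; as produced by
`InverseSquareRecessive.lean`). Then (`exists_dominant_of_recessive`) there is a second global
solution `V` with WRONSKIAN `U V' − U' V ≡ 1` and, for `z ≥ A + 1`, the dominant bounds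
`|V z| ≤ 6 zⁿ⁺¹`, `|V' z| ≤ 5 zⁿ`, together with `0 < U ≤ (3/2) z⁻ⁿ`, `|U'| ≤ (3n+1)/2 · z⁻ⁿ⁻¹`.
Construction: `V = U ∫_{A+1}^z U⁻²` on `(A, ∞)` (d'Alembert's reduction of order), globalised by
`SchrodingerODE.lean`; the Wronskian is constant (`(UV' − U'V)' = 0`) and equals `1` on `(A,∞)`.
These two solutions drive the variation-of-parameters construction of the true non-radiative
`t`-polynomial solutions of the far-side channel estimate (route PhotonSphereChannels,
`FixedModeChannels`, stmt-FinalStateConjecture-10048). Classical (Hartman, *ODE*, Ch. XI §9;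
Ch. IV §8 (reduction of order)).
-/

noncomputable section

namespace Literature.Analysis.ODE

open MeasureTheory Set Filter Topology intervalIntegral

variable {P U : ℝ → ℝ} {A η : ℝ} {n : ℕ}

/-- **Pointwise consequences of the recessive bounds**: for `z > A ≥ 1`, `η ≤ ½`:
`0 < U z`, `zⁿ U z ∈ [1/2, 3/2]`, `|U' z| ≤ (3n+1)/2 · z⁻ⁿ⁻¹`. [folklore] -/
theorem recessive_pointwise_bounds (hA : 1 ≤ A) (hη : η ≤ 1 / 2)
    (hU0 : ∀ z, A < z → |z ^ n * U z - 1| ≤ η)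
    (hU1 : ∀ z, A < z → |z ^ (n + 1) * deriv U z + n * (z ^ n * U z)| ≤ η) {z : ℝ} (hz : A < z) :
    0 < U z ∧ 1 / 2 ≤ z ^ n * U z ∧ z ^ n * U z ≤ 3 / 2 ∧
      |deriv U z| ≤ (3 * n + 1) / 2 * (z ^ (n + 1))⁻¹ := by
  have hz0 : 0 < z := by linarith
  have h0 := abs_le.1 (hU0 z hz)
  have h1 := abs_le.1 (hU1 z hz)
  have hlo : 1 / 2 ≤ z ^ n * U z := by linarith [h0.1]
  have hhi : z ^ n * U z ≤ 3 / 2 := by linarith [h0.2]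
  have hzn : 0 < z ^ n := pow_pos hz0 n
  have hUpos : 0 < U z := by
    rcases le_or_gt (U z) 0 with h | h
    · have : z ^ n * U z ≤ 0 := mul_nonpos_of_nonneg_of_nonpos hzn.le h
      linarith
    · exact h
  refine ⟨hUpos, hlo, hhi, ?_⟩
  have hzn1 : 0 < z ^ (n + 1) := pow_pos hz0 _
  have hn0 : (0 : ℝ) ≤ n := n.cast_nonneg
  have key : |z ^ (n + 1) * deriv U z| ≤ (3 * n + 1) / 2 := by
    have : |z ^ (n + 1) * deriv U z| ≤ |z ^ (n + 1) * deriv U z + n * (z ^ n * U z)|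
        + |(n : ℝ) * (z ^ n * U z)| := by
      have := abs_sub_le (z ^ (n + 1) * deriv U z + n * (z ^ n * U z)) (n * (z ^ n * U z)) 0
      simp only [sub_zero, add_sub_cancel_right] at this ⊢
      have h := abs_add_le (z ^ (n + 1) * deriv U z + n * (z ^ n * U z)) (-(n * (z ^ n * U z)))
      simp only [abs_neg, add_neg_cancel_right] at h
      exact h
    have h2 : |(n : ℝ) * (z ^ n * U z)| ≤ n * (3 / 2) := by
      rw [abs_mul, abs_of_nonneg hn0, abs_of_nonneg (by linarith)]
      exact mul_le_mul_of_nonneg_left hhi hn0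
    linarith [hU1 z hz]
  rw [abs_mul, abs_of_pos hzn1] at key
  rw [← div_eq_mul_inv, le_div_iff₀ hzn1]
  linarith

/-- **Dominant solution and Wronskian by reduction of order.** See the module docstring.
[cite: Hartman2002, Ch. XI §9] -/
theorem exists_dominant_of_recessive (hP : Continuous P) (hU : IsSchrodingerSol P U) (hA : 1 ≤ A)
    (hη : η ≤ 1 / 2) (hU0 : ∀ z, A < z → |z ^ n * U z - 1| ≤ η)
    (hU1 : ∀ z, A < z → |z ^ (n + 1) * deriv U z + n * (z ^ n * U z)| ≤ η) :
    ∃ V : ℝ → ℝ, IsSchrodingerSol P V ∧ (∀ z, U z * deriv V z - deriv U z * V z = 1) ∧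
      (∀ z, A + 1 ≤ z → |V z| ≤ 6 * z ^ (n + 1)) ∧
      (∀ z, A + 1 ≤ z → |deriv V z| ≤ 5 * z ^ n) := by
  have hpt := fun z (hz : A < z) => recessive_pointwise_bounds (U := U) hA hη hU0 hU1 hz
  set b₀ : ℝ := A + 1 with hb₀
  -- `I z = ∫_{b₀}^z U⁻²` and `vloc = U I` on `(A, ∞)`
  set w : ℝ → ℝ := fun s => (U s ^ 2)⁻¹ with hw
  have hwc : ContinuousOn w (Ioi A) := by
    refine ContinuousOn.inv₀ ((hU.continuous.pow 2).continuousOn) fun s hs => ?_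
    exact pow_ne_zero _ (hpt s hs).1.ne'
  set I : ℝ → ℝ := fun z => ∫ s in b₀..z, w s with hI
  have hIint : ∀ a b, A < a → A < b → IntervalIntegrable w volume a b := by
    intro a b ha hb
    refine (hwc.mono fun s hs => ?_).intervalIntegrable
    show A < s
    have : min a b ≤ s := hs.1
    have : A < min a b := lt_min ha hb
    linarith
  have hId : ∀ z, A < z → HasDerivAt I (w z) z := by
    intro z hz
    have hcont : ContinuousAt w z := hwc.continuousAt (Ioi_mem_nhds hz)
    exact intervalIntegral.integral_hasDerivAt_right (hIint b₀ z (by linarith) hz)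
      (hwc.stronglyMeasurableAtFilter isOpen_Ioi z hz) hcont
  set vloc : ℝ → ℝ := fun z => U z * I z with hvloc
  set vloc' : ℝ → ℝ := fun z => deriv U z * I z + (U z)⁻¹ with hvloc'
  have hvd : ∀ z, A < z → HasDerivAt vloc (vloc' z) z := by
    intro z hz
    have hUz : U z ≠ 0 := (hpt z hz).1.ne'
    have h := (hU.hasDerivAt z).mul (hId z hz)
    refine h.congr_deriv ?_
    simp only [hvloc', hw]; field_simp
  have hvd' : ∀ z, A < z → HasDerivAt vloc' (P z * vloc z) z := by
    intro z hz
    have hUz : U z ≠ 0 := (hpt z hz).1.ne'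
    have h1 := (hU.hasDerivAt_deriv z).mul (hId z hz)
    have h2 := (hU.hasDerivAt z).inv hUz
    have h := h1.add h2
    refine h.congr_deriv ?_
    simp only [hvloc, hw]; field_simp; ring
  -- globalise through the data at `b₀`
  obtain ⟨V, hV, hV0, hV1⟩ := exists_isSchrodingerSol hP b₀ (vloc b₀) (vloc' b₀)
  have hEq : ∀ z, A < z → vloc z = V z ∧ vloc' z = deriv V z := by
    intro z hz
    set b : ℝ := max z b₀ + 1 with hb
    have hzb : z < b := by simp only [hb]; linarith [le_max_left z b₀]
    have hb₀b : b₀ < b := by simp only [hb]; linarith [le_max_right z b₀]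
    obtain ⟨K, -, -, hK⟩ := exists_const_schrodingerField hP A b
    have key := ODE_solution_unique_of_mem_Ioo (v := schrodingerField P) (s := fun _ => univ)
      (K := K) (f := fun s => (vloc s, vloc' s)) (g := fun s => (V s, deriv V s))
      (a := A) (b := b) (t₀ := b₀)
      (fun τ hτ => ((hK τ (Ioo_subset_Icc_self hτ)).1).lipschitzOnWith) ⟨by simp only [hb₀]; linarith, hb₀b⟩
      (fun τ hτ => ⟨(hvd τ hτ.1).prodMk (hvd' τ hτ.1), mem_univ _⟩)
      (fun τ _ => ⟨hV.hasDerivAt_phase τ, mem_univ _⟩) (by simp [hV0, hV1]) ⟨hz, hzb⟩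
    exact ⟨congrArg Prod.fst key, congrArg Prod.snd key⟩
  -- the Wronskian is constant, `= 1` on `(A, ∞)`, hence everywhere
  have hWd : ∀ z, HasDerivAt (fun z => U z * deriv V z - deriv U z * V z) 0 z := by
    intro z
    have h := ((hU.hasDerivAt z).mul (hV.hasDerivAt_deriv z)).sub
      ((hU.hasDerivAt_deriv z).mul (hV.hasDerivAt z))
    refine h.congr_deriv ?_; ring
  have hWconst : ∀ z, U z * deriv V z - deriv U z * V z = U b₀ * deriv V b₀ - deriv U b₀ * V b₀ :=
    fun z => is_const_of_deriv_eq_zero (fun z => (hWd z).differentiableAt)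
      (fun z => (hWd z).deriv) z b₀
  have hWb₀ : U b₀ * deriv V b₀ - deriv U b₀ * V b₀ = 1 := by
    have hb : A < b₀ := by simp only [hb₀]; linarith
    rw [← (hEq b₀ hb).1, ← (hEq b₀ hb).2]
    have hUz : U b₀ ≠ 0 := (hpt b₀ hb).1.ne'
    simp only [hvloc, hvloc']; field_simp; ring
  have hW : ∀ z, U z * deriv V z - deriv U z * V z = 1 := fun z => (hWconst z).trans hWb₀
  -- bounds for `z ≥ b₀`
  have hIbd : ∀ z, b₀ ≤ z → 0 ≤ I z ∧ I z ≤ 4 * z ^ (2 * n + 1) / (2 * n + 1) := by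
    intro z hz
    have hAb : A < b₀ := by simp only [hb₀]; linarith
    have hwbd : ∀ s ∈ Icc b₀ z, 0 ≤ w s ∧ w s ≤ 4 * s ^ (2 * n) := by
      intro s hs
      have hsA : A < s := lt_of_lt_of_le hAb hs.1
      obtain ⟨hUp, hlo, -, -⟩ := hpt s hsA
      have hs0 : 0 < s := by linarith
      refine ⟨by simp only [hw]; positivity, ?_⟩
      simp only [hw]
      have hsn : 0 < s ^ n := pow_pos hs0 n
      have key : (1 / 2) ^ 2 ≤ (s ^ n * U s) ^ 2 := pow_le_pow_left₀ (by norm_num) hlo 2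
      rw [inv_le_comm₀ (by positivity) (by positivity)]
      calc (4 * s ^ (2 * n))⁻¹ = (1 / 2) ^ 2 / (s ^ n) ^ 2 := by
            rw [← pow_mul, mul_comm n 2]; field_simp; norm_num
        _ ≤ (s ^ n * U s) ^ 2 / (s ^ n) ^ 2 := div_le_div_of_nonneg_right key (by positivity)
        _ = U s ^ 2 := by field_simp
    have hint : IntervalIntegrable w volume b₀ z := hIint b₀ z hAb (lt_of_lt_of_le hAb hz)
    constructor
    · exact intervalIntegral.integral_nonneg hz fun s hs => (hwbd s hs).1
    · have hmono : I z ≤ ∫ s in b₀..z, 4 * s ^ (2 * n) :=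
        intervalIntegral.integral_mono_on hz hint
          ((continuous_const.mul (continuous_pow _)).intervalIntegrable _ _)
          fun s hs => (hwbd s hs).2
      have heval : (∫ s in b₀..z, 4 * s ^ (2 * n))
          = 4 * (z ^ (2 * n + 1) - b₀ ^ (2 * n + 1)) / (2 * n + 1) := by
        rw [intervalIntegral.integral_const_mul, integral_pow]; push_cast; ring
      have hb0 : 0 ≤ b₀ ^ (2 * n + 1) := pow_nonneg (by simp only [hb₀]; linarith) _
      have hN : (0 : ℝ) < 2 * n + 1 := by positivity
      rw [heval] at hmono
      calc I z ≤ 4 * (z ^ (2 * n + 1) - b₀ ^ (2 * n + 1)) / (2 * n + 1) := hmono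
        _ ≤ 4 * z ^ (2 * n + 1) / (2 * n + 1) := by
            apply div_le_div_of_nonneg_right _ hN.le
            linarith
  have hAb : A < b₀ := by simp only [hb₀]; linarith
  refine ⟨V, hV, hW, fun z hz => ?_, fun z hz => ?_⟩
  · have hzA : A < z := lt_of_lt_of_le hAb hz
    have hz0 : 0 < z := by linarith
    obtain ⟨hUp, -, hhi, -⟩ := hpt z hzA
    obtain ⟨hI0, hI1⟩ := hIbd z hz
    rw [← (hEq z hzA).1]
    simp only [hvloc]
    rw [abs_mul, abs_of_pos hUp, abs_of_nonneg hI0]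
    have hzn : 0 < z ^ n := pow_pos hz0 n
    have hUle : U z ≤ 3 / 2 * (z ^ n)⁻¹ := by
      rw [← div_eq_mul_inv, le_div_iff₀ hzn]; linarith
    have hN : (1 : ℝ) ≤ 2 * n + 1 := by have : (0:ℝ) ≤ n := n.cast_nonneg; linarith
    calc U z * I z ≤ (3 / 2 * (z ^ n)⁻¹) * (4 * z ^ (2 * n + 1) / (2 * n + 1)) :=
          mul_le_mul hUle hI1 hI0 (by positivity)
      _ = 6 * z ^ (n + 1) / (2 * n + 1) := by
          rw [pow_succ, pow_add, pow_mul]; field_simp; ring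
      _ ≤ 6 * z ^ (n + 1) / 1 := div_le_div_of_nonneg_left (by positivity) one_pos hN
      _ = 6 * z ^ (n + 1) := div_one _
  · have hzA : A < z := lt_of_lt_of_le hAb hz
    have hz0 : 0 < z := by linarith
    obtain ⟨hUp, hlo, -, hU'⟩ := hpt z hzA
    obtain ⟨hI0, hI1⟩ := hIbd z hz
    rw [← (hEq z hzA).2]
    simp only [hvloc']
    have hzn : 0 < z ^ n := pow_pos hz0 n
    have hzn1 : 0 < z ^ (n + 1) := pow_pos hz0 _
    have hinvU : (U z)⁻¹ ≤ 2 * z ^ n := by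
      rw [inv_le_comm₀ hUp (by positivity)]
      calc (2 * z ^ n)⁻¹ = (1 / 2) / z ^ n := by field_simp
        _ ≤ (z ^ n * U z) / z ^ n := div_le_div_of_nonneg_right hlo hzn.le
        _ = U z := by field_simp
    have hN0 : (0 : ℝ) < 2 * n + 1 := by positivity
    have h1 : |deriv U z * I z| ≤ 3 * z ^ n := by
      rw [abs_mul, abs_of_nonneg hI0]
      calc |deriv U z| * I z ≤ ((3 * n + 1) / 2 * (z ^ (n + 1))⁻¹) * (4 * z ^ (2 * n + 1) / (2 * n + 1)) :=
            mul_le_mul hU' hI1 hI0 (by positivity)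
        _ = (2 * (3 * n + 1) / (2 * n + 1)) * z ^ n := by
            rw [pow_succ, pow_add, pow_mul]; field_simp; ring
        _ ≤ 3 * z ^ n := by
            refine mul_le_mul_of_nonneg_right ?_ hzn.le
            rw [div_le_iff₀ hN0]; have : (0:ℝ) ≤ n := n.cast_nonneg; linarith
    have h2 : |(U z)⁻¹| ≤ 2 * z ^ n := by rw [abs_of_pos (inv_pos.2 hUp)]; exact hinvU
    calc |deriv U z * I z + (U z)⁻¹| ≤ |deriv U z * I z| + |(U z)⁻¹| := abs_add_le _ _
      _ ≤ 3 * z ^ n + 2 * z ^ n := add_le_add h1 h2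
      _ = 5 * z ^ n := by ring

end Literature.Analysis.ODE
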